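import Mathlib
import Summits.Ventures.HodgeRepro2.Tier7.Target
import Summits.Ventures.HodgeRepro2.Tier7.Common.Shadow

/-!
# Tier7/Common/Hecke — Hecke spans and the consequences of semisimplicity (t7-typer-1)

Cell pub-hodge-repro2, Tier 7 (README §11–§12), seat t7-typer-1 (sole filer of `Tier7/Common/**`).
Proof lane: everything below is PROVED from the fields of `SurfaceShadow HX G` as frozen in
`Tier7/Target.lean`; no new carrier, no new field, no axiom, no `sorry`. Nothing here asserts the step.

CONTENT. (1) The Hecke span `heckeSpan G v = span_ℂ {g • v}` (the Hecke module generated by `v`): Hecke-stable,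
contained in every Hecke-stable subspace containing `v`, and EQUAL to a Hecke-irreducible `U ∋ v ≠ 0`
(`heckeSpan_eq_of_irred`: the «π_i^K = H · θ(μ_i)» of the Hecke-density lines, a lemma of the frozen fields).
(2) Consequences of (H9) `H20_semisimple`: Hecke-stability is closed under `⊥`, `⊓`, `⨆`; the socle of a
subspace (the sup of the Hecke-irreducible subspaces it contains) and `socle_eq_self` — every Hecke-stable
subspace of `H^{1,0} ∧ H^{1,0}` is the sup of its Hecke-irreducible subspaces (complement clause + socle clause
+ the modular law) — and `exists_irred_le_heckeSpan`: the Hecke module generated by a non-zero holomorphic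
2-form contains a Hecke-irreducible subspace.

§8(d): uses an L-value-free non-vanishing device: NO (general lemmas over the carriers).
-/

namespace Summit.Ventures.HodgeRepro2.Tier7

noncomputable section

/-! ### 1. Hecke spans -/


section HeckeSpan

variable {HX : Type} [Ring HX] [Algebra ℂ HX] (G : Type) [Group G] [MulAction G HX]

/-- The ℂ-span of the Hecke translates of `v` (the Hecke module generated by `v`). -/
def heckeSpan (v : HX) : Submodule ℂ HX := Submodule.span ℂ (Set.range fun g : G => g • v)

/-- Every Hecke translate of `v` lies in its Hecke span. -/
theorem smul_mem_heckeSpan (g : G) (v : HX) : g • v ∈ heckeSpan G v :=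
  Submodule.subset_span ⟨g, rfl⟩

/-- `v` lies in its own Hecke span (`g = 1`). -/
theorem self_mem_heckeSpan (v : HX) : v ∈ heckeSpan G v := by
  simpa using smul_mem_heckeSpan G 1 v

/-- The Hecke span of a non-zero vector is non-zero. -/
theorem heckeSpan_ne_bot {v : HX} (hv : v ≠ 0) : heckeSpan G v ≠ ⊥ := by
  intro h
  have := self_mem_heckeSpan G v
  rw [h, Submodule.mem_bot] at this
  exact hv this

variable {G}

/-- The Hecke span is Hecke-stable. -/
theorem heckeSpan_stable (S : SurfaceShadow HX G) (v : HX) : HeckeStable G (heckeSpan G v) := by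
  intro g a ha
  unfold heckeSpan at ha ⊢
  refine Submodule.span_induction (p := fun a _ => g • a ∈ Submodule.span ℂ (Set.range fun g : G => g • v))
    ?_ ?_ ?_ ?_ ha
  · rintro _ ⟨h, rfl⟩
    rw [smul_smul]
    exact Submodule.subset_span ⟨g * h, rfl⟩
  · rw [S.act_zero]; exact Submodule.zero_mem _
  · intro x y _ _ hx hy
    rw [S.act_add]; exact Submodule.add_mem _ hx hy
  · intro c x _ hx
    rw [S.act_smul]; exact Submodule.smul_mem _ c hx

/-- The Hecke span of `v` is contained in every Hecke-stable subspace containing `v`. -/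
theorem heckeSpan_le_of_mem {U : Submodule ℂ HX} (hU : HeckeStable G U) {v : HX} (hv : v ∈ U) :
    heckeSpan G v ≤ U := by
  unfold heckeSpan
  refine Submodule.span_le.mpr ?_
  rintro _ ⟨g, rfl⟩
  exact hU g v hv

/-- HECKE DENSITY: a non-zero vector of a Hecke-irreducible subspace generates it —
`span_ℂ {g • v} = U` for `U` Hecke-irreducible, `v ∈ U`, `v ≠ 0`. -/
theorem heckeSpan_eq_of_irred (S : SurfaceShadow HX G) {U : Submodule ℂ HX} (hU : HeckeIrred G U)
    {v : HX} (hv : v ∈ U) (h0 : v ≠ 0) : heckeSpan G v = U := by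
  rcases hU.2.2 _ (heckeSpan_le_of_mem hU.2.1 hv) (heckeSpan_stable S v) with h | h
  · exact absurd h (heckeSpan_ne_bot G h0)
  · exact h

/-- Every vector of a Hecke-irreducible subspace is a ℂ-linear combination of Hecke translates of any
non-zero vector of it. -/
theorem mem_heckeSpan_of_irred (S : SurfaceShadow HX G) {U : Submodule ℂ HX} (hU : HeckeIrred G U)
    {v : HX} (hv : v ∈ U) (h0 : v ≠ 0) {w : HX} (hw : w ∈ U) : w ∈ heckeSpan G v := by
  rw [heckeSpan_eq_of_irred S hU hv h0]; exact hw


section Semisimple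

/-! ### 2. Consequences of semisimplicity (H9) -/

variable {HX : Type} [Ring HX] [Algebra ℂ HX] {G : Type} [Group G] [MulAction G HX]

/-- `⊥` is Hecke-stable. -/
theorem heckeStable_bot (S : SurfaceShadow HX G) : HeckeStable G (⊥ : Submodule ℂ HX) :=
  fun _ a ha => by
    rw [Submodule.mem_bot] at ha ⊢; rw [ha]; exact S.act_zero _

/-- The intersection of two Hecke-stable subspaces is Hecke-stable. -/
theorem heckeStable_inf {U U' : Submodule ℂ HX} (hU : HeckeStable G U) (hU' : HeckeStable G U') :
    HeckeStable G (U ⊓ U') := fun g a ha => ⟨hU g a ha.1, hU' g a ha.2⟩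

/-- A sup of Hecke-stable subspaces is Hecke-stable. -/
theorem heckeStable_iSup (S : SurfaceShadow HX G) {ι : Sort*} {U : ι → Submodule ℂ HX}
    (hU : ∀ i, HeckeStable G (U i)) : HeckeStable G (⨆ i, U i) := by
  intro g a ha
  have hle : ⨆ i, U i ≤ (⨆ i, U i).comap (S.actLinear g) := by
    refine iSup_le fun i => ?_
    intro x hx
    exact Submodule.mem_comap.mpr (Submodule.mem_iSup_of_mem i (hU i g x hx))
  exact Submodule.mem_comap.mp (hle ha)

/-- `H^{1,0} ∧ H^{1,0}` is Hecke-stable. -/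
theorem heckeStable_H20 (S : SurfaceShadow HX G) : HeckeStable G (S.H10 * S.H10) :=
  fun g _ ha => S.H20_stable g ha

variable (G)

/-- The socle of a subspace: the sup of the Hecke-irreducible subspaces it contains. -/
def socle (U : Submodule ℂ HX) : Submodule ℂ HX :=
  ⨆ W : {W : Submodule ℂ HX // W ≤ U ∧ HeckeIrred G W}, (W : Submodule ℂ HX)

/-- The socle of `U` lies in `U`. -/
theorem socle_le (U : Submodule ℂ HX) : socle G U ≤ U :=
  iSup_le fun W => W.2.1

variable {G}

/-- A Hecke-irreducible subspace of `U` lies in the socle of `U`. -/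
theorem le_socle_of_irred {U W : Submodule ℂ HX} (hW : W ≤ U) (hirr : HeckeIrred G W) :
    W ≤ socle G U :=
  le_iSup (fun W : {W : Submodule ℂ HX // W ≤ U ∧ HeckeIrred G W} => (W : Submodule ℂ HX)) ⟨W, hW, hirr⟩

/-- The socle is Hecke-stable. -/
theorem heckeStable_socle (S : SurfaceShadow HX G) (U : Submodule ℂ HX) : HeckeStable G (socle G U) :=
  heckeStable_iSup S fun W => W.2.2.2.1

/-- SEMISIMPLICITY IN USE: every Hecke-stable subspace of `H^{1,0} ∧ H^{1,0}` is the sup of the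
Hecke-irreducible subspaces it contains (from the complement clause and the socle clause of `H20_semisimple`,
by the modular law). -/
theorem socle_eq_self (S : SurfaceShadow HX G) {U : Submodule ℂ HX} (hU : U ≤ S.H10 * S.H10)
    (hst : HeckeStable G U) : socle G U = U := by
  obtain ⟨⟨U', _, hU'st, hinf, hsup⟩, _⟩ :=
    S.H20_semisimple (socle G U) ((socle_le G U).trans hU) (heckeStable_socle S U)
  -- `U ⊓ U'` is Hecke-stable inside `H^{1,0} ∧ H^{1,0}`; if non-zero it contains an irreducible `W ≤ U`,
  -- which then lies in `socle U ⊓ U' = ⊥`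
  have hUU' : U ⊓ U' = ⊥ := by
    by_contra hne
    obtain ⟨_, hsoc⟩ := S.H20_semisimple (U ⊓ U') (inf_le_left.trans hU) (heckeStable_inf hst hU'st)
    obtain ⟨W, hWle, hWirr⟩ := hsoc hne
    have h1 : W ≤ socle G U := le_socle_of_irred (hWle.trans inf_le_left) hWirr
    have h2 : W ≤ U' := hWle.trans inf_le_right
    have h3 : W ≤ socle G U ⊓ U' := le_inf h1 h2
    rw [hinf] at h3
    exact hWirr.1 (le_bot_iff.mp h3)
  -- modular law: `U = U ⊓ (socle U ⊔ U') = socle U ⊔ (U ⊓ U') = socle U`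
  have hmod : U ⊓ (socle G U ⊔ U') = socle G U ⊔ (U ⊓ U') := by
    rw [inf_comm, sup_inf_assoc_of_le U' (socle_le G U), inf_comm]
  rw [hUU', sup_bot_eq, hsup, inf_eq_left.mpr hU] at hmod
  exact hmod.symm

/-- A non-zero Hecke-stable subspace of `H^{1,0} ∧ H^{1,0}` contains a Hecke-irreducible subspace. -/
theorem exists_irred_le (S : SurfaceShadow HX G) {U : Submodule ℂ HX} (hU : U ≤ S.H10 * S.H10)
    (hst : HeckeStable G U) (hne : U ≠ ⊥) : ∃ W : Submodule ℂ HX, W ≤ U ∧ HeckeIrred G W :=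
  (S.H20_semisimple U hU hst).2 hne

/-- In particular the Hecke module generated by a non-zero holomorphic 2-form contains an irreducible one. -/
theorem exists_irred_le_heckeSpan (S : SurfaceShadow HX G) {a : HX} (ha : a ∈ S.H10 * S.H10)
    (h0 : a ≠ 0) : ∃ W : Submodule ℂ HX, W ≤ heckeSpan G a ∧ HeckeIrred G W :=
  exists_irred_le S (heckeSpan_le_of_mem (heckeStable_H20 S) ha) (heckeSpan_stable S a)
    (heckeSpan_ne_bot G h0)

end Semisimple

end HeckeSpan




end

end Summit.Ventures.HodgeRepro2.Tier7
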